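import Summits.BirchSwinnertonDyer.Rank1Residual.P2.CongruentNumberOddAokiMonskyShape
import Summits.BirchSwinnertonDyer.Rank1Residual.P2.CongruentNumberOddAokiMonskyRestrict
import Mathlib.Data.Matrix.ColumnRowPartitioned
import HarnessLib

/-!
# Cell `bsd-monsky`: AOKI = MONSKY, THE ODD CLASS `n ≡ 7 (mod 8)` — preparation: the `2`-adic essential condition
# `x_w ≡ 1 (mod 8)` as TWO linear conditions, and the rank of a matrix with one appended column (nothing asserted)

HONEST FRAMING (cell `bsd-monsky`, run/shared/lean/pub/bsd-monsky/, README §1). This file asserts NO arithmetic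
fact and carries NO named-fact binder. It is groundwork for the last class `n ≡ 7 (mod 8)` of «Aoki 1999 Thm 2.2
≡ Monsky's matrix count» (classes `6` and `3 (mod 8)` are the tree theorems `selmerDimFormula_two_mul_prod`,
`selmerDimFormula_prod_three`; plan: HOME/proof/PROOF-B-AOKI-MONSKY.md §5.1):
* §1 for an odd integer `x`: `{2, x}₂ = 0 ∧ {−1, x}₂ = 0 ⟺ x ≡ 1 (mod 8)` (Serre's explicit `2`-adic symbols:
  `(2, x)₂ = χ₈(x)`, `(−1, x)₂ = (−1)^{ε(x)}`); both symbols are additive over Aoki's representative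
  `x_w = ∏ x^{w_x}`; `{−1, p_i}₂ = ε_i = [p_i ≡ 3 (4)]`; hence for `n = p₁⋯p_k ≡ 7 (mod 8)` Aoki's printed condition
  `x_w ≡ 1 (mod 8)` is the pair of LINEAR conditions `Σ_x w_x λ₂(x) = 0 ∧ Σ_x w_x {−1, x}₂ = 0`
  (`essentialCond_prod_seven_iff`) — the essential space is `W₀ ∩ ker(t ⬝ ·) ∩ ker(ε ⬝ ·)`;
* §2 the rank of a matrix with one appended column: `rank [C | t] = rank C + [t ∉ col C]`
  (`rank_fromCols_single`) — for Aoki's `Λ_{S,T}` with `T = T₁ ∪ {2}`.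

References: [Aoki1999] §2 p. 80, Thm. 2.2 p. 81; [Serre1973] Ch. III §1.2 Thm. 1; any linear algebra text [folklore].
-/

noncomputable section

open scoped Classical

open Matrix WeierstrassCurve Literature.NumberTheory.EllipticCurves
  Literature.NumberTheory.EllipticCurves.Aoki1999
  Literature.NumberTheory.EllipticCurves.HeathBrown1994
  Literature.NumberTheory.EllipticCurves.HeathBrown1994.Families
  Literature.NumberTheory.QuadraticForms

set_option autoImplicit false

namespace Summit.BirchSwinnertonDyer.Rank1Residual.P2.AokiMonsky

/-! ## §1 The `2`-adic condition `x ≡ 1 (mod 8)` through `{2, x}₂` and `{−1, x}₂` -/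

section TwoAdic

/-- `{a, x^m}_ℓ = m · {a, x}_ℓ`. [cite: Serre1973, Ch. III §1.2 Thm. 2] -/
theorem hilbertBit_pow {ℓ : ℕ} [Fact ℓ.Prime] {a x : ℤ} (ha : a ≠ 0) (hx : x ≠ 0) (m : ℕ) :
    hilbertBit ℓ a (x ^ m) = (m : ZMod 2) * hilbertBit ℓ a x := by
  induction m with
  | zero => simp [hilbertBit_one_right]
  | succ m ih =>
    rw [pow_succ, hilbertBit_mul_right ha (pow_ne_zero m hx) hx, ih]
    push_cast
    ring

/-- `{a, x_w}_ℓ = Σ_x w_x {a, x}_ℓ` on Aoki's representative `x_w = ∏ x^{w_x}`. [cite: Aoki1999, §2 p. 80] -/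
theorem hilbertBit_rep {ℓ : ℕ} [Fact ℓ.Prime] {a : ℤ} (ha : a ≠ 0) (n : ℕ)
    (w : ↥(sOneSet n) → ZMod 2) :
    hilbertBit ℓ a (rep n w) = ∑ x : ↥(sOneSet n), w x * hilbertBit ℓ a ((x : ℕ) : ℤ) := by
  unfold rep
  have hne : ∀ x : ↥(sOneSet n), ((x : ℕ) : ℤ) ≠ 0 := fun x => by
    exact_mod_cast (Nat.prime_of_mem_primeFactors (Finset.mem_filter.mp x.2).1).ne_zero
  rw [hilbertBit_finset_prod_right ha _ _ fun x _ => pow_ne_zero _ (hne x)]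
  exact Finset.sum_congr rfl fun x _ => by
    rw [hilbertBit_pow ha (hne x), ZMod.natCast_val, ZMod.cast_id', id]

/-- `{−1, x}₂ = 0 ⟺ x ≡ 1 (mod 4)` for odd `x` (`(−1, x)₂ = (−1)^{ε(x)}`). [cite: Serre1973, Ch. III §1.2 Thm. 1] -/
theorem hilbertBit_two_neg_one_eq_zero_iff {x : ℤ} (hx : ¬ (2 : ℤ) ∣ x) :
    hilbertBit 2 (-1) x = 0 ↔ x % 4 = 1 := by
  have hx0 : x ≠ 0 := fun h => hx (h ▸ dvd_zero 2)
  rw [hilbertBit_eq_zero_iff (by norm_num) hx0, localSign_two_odd_odd rfl (by norm_num) hx,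
    epsSign_neg_one_left, ZMod.χ₄_int_eq_if_mod_four, if_neg (fun h => hx (Int.dvd_of_emod_eq_zero h))]
  by_cases h4 : x % 4 = 1
  · simp [h4]
  · simp [h4]

/-- `x ≡ 1 (mod 8) ⟺ {2, x}₂ = 0 ∧ {−1, x}₂ = 0` for odd `x` (as Aoki's `λ₂` and the symbol `{−1, ·}₂`).
[cite: Serre1973, Ch. III §1.2 Thm. 1] -/
theorem int_mod_eight_eq_one_iff (n : ℕ) {x : ℤ} (hx : ¬ (2 : ℤ) ∣ x) :
    x % 8 = 1 ↔ lam n 2 x = 0 ∧ hilbertBit 2 (-1) x = 0 := by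
  rw [lam_two_eq_zero_iff_mod_eight n hx, hilbertBit_two_neg_one_eq_zero_iff hx]
  omega

variable {k : ℕ} (p : Fin k → ℕ) (hp : ∀ i, (p i).Prime) (hodd : ∀ i, Odd (p i))
  (hinj : Function.Injective p)

include hodd in
/-- `{−1, p_i}₂ = ε_i = [p_i ≡ 3 (mod 4)]`. [cite: Serre1973, Ch. III §1.2 Thm. 1] -/
theorem hilbertBit_two_neg_one_prime (i : Fin k) :
    hilbertBit 2 (-1) (p i) = addLegendreSym (-1) (p i) := by
  have h01 : ∀ y : ZMod 2, y = 0 ∨ y = 1 := by decide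
  have hpi : ¬ (2 : ℤ) ∣ (p i : ℤ) := by
    intro h
    have : 2 ∣ p i := by exact_mod_cast h
    exact (Nat.not_even_iff_odd.mpr (hodd i)) (even_iff_two_dvd.mpr this)
  have key : hilbertBit 2 (-1) (p i) = 0 ↔ addLegendreSym (-1) (p i) = 0 := by
    rw [hilbertBit_two_neg_one_eq_zero_iff hpi, eps_eq_zero_iff p hodd i]
    omega
  rcases h01 (hilbertBit 2 (-1) (p i)) with h | h <;>
    rcases h01 (addLegendreSym (-1) (p i)) with h' | h'
  · rw [h, h']
  · exact absurd (key.mp h) (by rw [h']; decide)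
  · exact absurd (key.mpr h') (by rw [h]; decide)
  · rw [h, h']

include hp hodd hinj in
/-- **For `n ≡ 7 (mod 8)` the printed `2`-adic condition `x_w ≡ 1 (mod 8)` is the PAIR of linear conditions
`Σ_x w_x λ₂(x) = 0 ∧ Σ_x w_x {−1, x}₂ = 0`** on the exponent vector. [cite: Aoki1999, §2 p. 80] -/
theorem essentialCond_prod_seven_iff (h7 : (∏ i, p i) % 8 = 7) (w : ↥(sOneSet (∏ i, p i)) → ZMod 2) :
    essentialCond (∏ i, p i) (rep (∏ i, p i) w) ↔
      (∑ x : ↥(sOneSet (∏ i, p i)), w x * lam (∏ i, p i) 2 ((x : ℕ) : ℤ) = 0) ∧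
        ∑ x : ↥(sOneSet (∏ i, p i)), w x * hilbertBit 2 (-1) ((x : ℕ) : ℤ) = 0 := by
  have hn0 : (∏ i, p i) ≠ 0 := Finset.prod_ne_zero_iff.mpr fun i _ => (hp i).ne_zero
  unfold essentialCond
  rw [if_pos (Or.inr h7), int_mod_eight_eq_one_iff (∏ i, p i) (not_two_dvd_rep_prod p hp hodd hinj w),
    lam_rep hn0, hilbertBit_rep (by norm_num) (∏ i, p i)]

end TwoAdic

/-! ## §2 The rank of a matrix with one appended column -/

section AppendColumn

variable {K : Type*} [Field K] {ι κ : Type*} [Fintype ι] [Fintype κ]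

omit [Fintype ι] in
/-- The column space of `[C | t]` is `col C + Kt`. [folklore] -/
theorem range_mulVecLin_fromCols_single (C : Matrix ι κ K) (t : ι → K) :
    LinearMap.range (Matrix.fromCols C (Matrix.of fun (i : ι) (_ : Unit) => t i)).mulVecLin =
      LinearMap.range C.mulVecLin ⊔ K ∙ t := by
  apply le_antisymm
  · rintro _ ⟨y, rfl⟩
    rw [Matrix.mulVecLin_apply, Matrix.fromCols_mulVec]
    refine Submodule.add_mem_sup ⟨y ∘ Sum.inl, rfl⟩ (Submodule.mem_span_singleton.mpr ⟨y (Sum.inr ()), ?_⟩)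
    ext i
    simp [Matrix.mulVec, dotProduct, mul_comm]
  · apply sup_le
    · rintro _ ⟨y, rfl⟩
      refine ⟨Sum.elim y 0, ?_⟩
      rw [Matrix.mulVecLin_apply, Matrix.fromCols_mulVec, Sum.elim_comp_inl, Sum.elim_comp_inr,
        Matrix.mulVec_zero, add_zero]
      rfl
    · rw [Submodule.span_singleton_le_iff_mem]
      refine ⟨Sum.elim 0 (fun _ => 1), ?_⟩
      rw [Matrix.mulVecLin_apply, Matrix.fromCols_mulVec, Sum.elim_comp_inl, Sum.elim_comp_inr,
        Matrix.mulVec_zero, zero_add]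
      ext i
      simp [Matrix.mulVec, dotProduct]

/-- **`rank [C | t] = rank C + [t ∉ col C]`**: appending one column raises the rank by one exactly when the column
is not in the column space. [folklore] -/
theorem rank_fromCols_single (C : Matrix ι κ K) (t : ι → K) :
    (Matrix.fromCols C (Matrix.of fun (i : ι) (_ : Unit) => t i)).rank =
      C.rank + if t ∈ LinearMap.range C.mulVecLin then 0 else 1 := by
  rw [Matrix.rank, range_mulVecLin_fromCols_single, Matrix.rank]
  split_ifs with h
  · rw [add_zero, sup_eq_left.mpr ((Submodule.span_singleton_le_iff_mem _ _).mpr h)]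
  · exact finrank_sup_span_singleton _ h

end AppendColumn

end Summit.BirchSwinnertonDyer.Rank1Residual.P2.AokiMonsky

end
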